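import Mathlib
import HarnessLib
import Summits.NavierStokesRegularity.NavierStokesRegularity.Theorems.UnthreadedRigidityDoorUnthreadedRigidityHornPressureBracket
import Summits.NavierStokesRegularity.NavierStokesRegularity.Theorems.UnthreadedRigidityDoorUnthreadedRigidityThreadingJetsWindowPressure
import Summits.NavierStokesRegularity.NavierStokesRegularity.Theorems.UnthreadedRigidityDoorUnthreadedRigidityVirialHornShellDecay
import Summits.NavierStokesRegularity.NavierStokesRegularity.Theorems.UnthreadedRigidityDoorUnthreadedRigidityPressureHornDefs

/-!
# Route `UnthreadedRigidityDoor`, item `UnthreadedRigidity` (W2, stmt-NavierStokesRegularity-27585) — LINE g10-2 «PROFILE HORN»,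
# BRIDGE PH-W BY NAME: `hornWindowSilence_holds` (and PRESSURE HORN's time-dependent form `hornWindowSilenceVar_holds`)

Prover file (W2 Lean hand ns-crc-p1 g9, by lineage; `--supports stmt-NavierStokesRegularity-27585 --as helper`).  With the horn slice identity
`hornSliceIdentityTwo_holds` (`…HornPressureBracket`) the WINDOW bridges of the horn lines follow from the tree's window machinery:

* `inner_curl_sepShell_sub` — a separable `l = 2` shell is UNTHREADED about its centre: `⟪curl (sepShell H Q x₀) x, x − x₀⟫ = 0` (its vorticity
  is toroidal, `VirialHorn.exists_curl_curl_curl_shell`), so in a window of such slices the threading flux vanishes identically and with it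
  every time derivative at interior times;
* at a time `t` of the window, g8's pressure gauge `ThreadingJets.exists_classical_decaying_pressure` (FJR strip + Tao/KNSS normalisation, fed
  with engine-1's `VirialHorn.memLp_four_sepShellL`) gives a classical `(u,p)` on an open strip around `t` with `p(t) → 0`; the open-window jet
  dictionary `ThreadingJets.iteratedDeriv_two_threadingFlux_eq_fluxJetTwo` and `laplacian_pressure_eq` turn the slice at `t` into the data of
  `HornSliceIdentityTwo`, whence `K(r)·r³·D_Q(y)·W̃(r) = 0` for all `r > 0`, `|y| = 1`, i.e. `Q` zonal or `K·W̃ ≡ 0` on `(0,∞)`: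
* ★★ `hornWindowSilenceVar_holds : PressureHorn.HornWindowSilenceVar` (K2-p2 g13's PRESSURE HORN bridge PH-W′, form and profile time-dependent),
* ★★ `hornWindowSilence_holds : ProfileHorn.HornWindowSilence` (g10-2's bridge PH-W, fixed form).

HONEST LABEL: statements about HYPOTHETICAL bounded mild windows all of whose slices are SPECIAL separable `l = 2` shells; they are bridges of RUNG
lines on the wall item, not the item: `UnthreadedRigidity` (27585), W2 and NS regularity remain OPEN; no summit statement is proved here.  0 kit.
-/

-- the summit and its single sub-problem share the name (CONVENTIONS §1), as in every Theorems file
set_option linter.dupNamespace false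

noncomputable section

namespace Summit.NavierStokesRegularity.NavierStokesRegularity.Theorems.UnthreadedRigidity.HornPressure

open scoped RealInnerProductSpace Topology ContDiff Laplacian
open Filter Set MeasureTheory Function
open Literature.Analysis.FluidPDE Literature.Analysis.UnboundedOperators
open Summit.NavierStokesRegularity.NavierStokesRegularity.Theorems.UnthreadedRigidity.ProfileHorn
  (E3 threadingFlux IsQuadForm quadY discrCubic IsZonalForm sepShell HornAdmissible vortAmp hornBracket)
open Summit.NavierStokesRegularity.NavierStokesRegularity.Theorems.UnthreadedRigidity.VirialHorn
open Summit.NavierStokesRegularity.NavierStokesRegularity.Theorems.UnthreadedRigidity.ThreadingJets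
  (fluxJetTwo exists_classical_decaying_pressure iteratedDeriv_two_threadingFlux_eq_fluxJetTwo laplacian_pressure_eq)

/-- A SEPARABLE `l = 2` SHELL IS UNTHREADED about its centre: `⟪curl (sepShell H Q x₀) x, x − x₀⟫ = 0` (toroidal vorticity). -/
theorem inner_curl_sepShell_sub {Q : Matrix (Fin 3) (Fin 3) ℝ} (hQ : IsQuadForm Q) {H h : ℝ → ℝ} (hh : ContDiff ℝ (⊤ : ℕ∞) h)
    (hH : ∀ r, 0 ≤ r → H r = h (r ^ 2)) (x₀ x : E3) :
    inner ℝ (curl (sepShell H Q x₀) x) (x - x₀) = 0 := by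
  obtain ⟨c, -, hc⟩ := exists_curl_curl_curl_shell hh (isSolidHarmonic_quadY hQ)
  rw [sepShell_eq_sepShellL, sepShellL_eq_comp_sub hH, curl_comp_sub_const_fun, hc]
  simp [inner_neg_left, inner_smul_left, inner_cross_self_right]

/-- ★★ BRIDGE PH-W′ BY NAME (`PressureHorn.HornWindowSilenceVar`, K2-p2 g13's PRESSURE HORN line; form and profile may depend on `t`):
in a bounded mild window all of whose slices are separable `l = 2` shells about `x₀` with horn-admissible profiles, at every time the form is zonal
or the profile solves the horn equation `K·W̃ ≡ 0` on `(0,∞)`. -/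
theorem hornWindowSilenceVar_holds : PressureHorn.HornWindowSilenceVar := by
  intro S hS u x₀ hcont hdiv hmild hbdd Hf Qf hslice t ht
  -- every slice is unthreaded, hence the flux vanishes on the window
  have hunth : ∀ τ ∈ S, ∀ x, inner ℝ (curl (u τ) x) (x - x₀) = 0 := by
    intro τ hτ x
    obtain ⟨⟨⟨h, hh, hH⟩, -⟩, hQ, hu⟩ := hslice τ hτ
    rw [hu]
    exact inner_curl_sepShell_sub hQ hh hH x₀ x
  -- `L⁴` slices
  have h4 : ∀ τ ∈ S, MemLp (u τ) 4 volume := by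
    intro τ hτ
    obtain ⟨hHa, hQ, hu⟩ := hslice τ hτ
    rw [hu, sepShell_eq_sepShellL]
    exact memLp_four_sepShellL 2 _ _ x₀ (by norm_num) (virialAdmissible_two_of_hornAdmissible hHa) (isSolidHarmonic_quadY hQ)
  -- the pressure gauge at `t`
  obtain ⟨s, T₂, hst, htT, hsub, p, hcl, hdec⟩ := exists_classical_decaying_pressure hS hcont hdiv hmild hbdd h4 ht
  have htJ : t ∈ Ioo s T₂ := ⟨hst, htT⟩
  obtain ⟨hHa, hQ, hu⟩ := hslice t ht
  have hsm : ContDiff ℝ ∞ (sepShell (Hf t) (Qf t) x₀) := by rw [← hu]; exact hcl.contDiff_velocity htJ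
  have hdv : VectorCalculus.IsDivFree (sepShell (Hf t) (Qf t) x₀) := by rw [← hu]; exact hcl.divFree t htJ
  have hps : ContDiff ℝ ∞ (p t) := hcl.contDiff_pressure htJ
  have hpoi : ∀ x : E3, (Δ (p t)) x =
      -VectorCalculus.divergence (convect (sepShell (Hf t) (Qf t) x₀) (sepShell (Hf t) (Qf t) x₀)) x := by
    intro x
    rw [← hu]
    exact laplacian_pressure_eq hcl isOpen_Ioo.uniqueDiffOn (by rw [isOpen_Ioo.interior_eq]; exact subset_closure) htJ x
  -- the horn identity at the slice, with vanishing left-hand side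
  have key : ∀ r : ℝ, 0 < r → ∀ y : E3, ‖y‖ = 1 →
      vortAmp (Hf t) r * r ^ 3 * discrCubic (Qf t) y * hornBracket (Hf t) r = 0 := by
    intro r hr y hy
    have h1 := hornSliceIdentityTwo_holds (Qf t) (Hf t) x₀ (p t) hQ hHa hsm hdv hps hpoi hdec r hr y hy
    have hev : (fun τ => threadingFlux u x₀ τ (x₀ + r • y)) =ᶠ[𝓝[univ] t] fun _ => (0 : ℝ) := by
      apply Filter.Eventually.filter_mono nhdsWithin_le_nhds
      filter_upwards [hS.mem_nhds ht] with τ hτ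
      exact hunth τ hτ _
    have h2 : fluxJetTwo (u t) (p t) x₀ (x₀ + r • y) = 0 := by
      rw [← iteratedDeriv_two_threadingFlux_eq_fluxJetTwo hcl isOpen_Ioo htJ x₀ (x₀ + r • y), ← iteratedDerivWithin_univ,
        hev.iteratedDerivWithin_eq (hunth t ht _), iteratedDerivWithin_const]
      simp
    rw [hu] at h2
    rw [h2] at h1
    exact h1.symm
  -- read off: `Q` zonal, or `K·W̃ ≡ 0`
  by_cases hz : IsZonalForm (Qf t)
  · exact Or.inl hz
  · right
    intro r hr
    obtain ⟨y, hy, hD⟩ : ∃ y : E3, ‖y‖ = 1 ∧ discrCubic (Qf t) y ≠ 0 := by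
      simpa [IsZonalForm, not_forall] using hz
    have h := key r hr y hy
    have hr3 : r ^ 3 ≠ 0 := pow_ne_zero 3 hr.ne'
    have : vortAmp (Hf t) r * hornBracket (Hf t) r * (r ^ 3 * discrCubic (Qf t) y) = 0 := by
      rw [← h]; ring
    rcases mul_eq_zero.1 this with h0 | h0
    · exact h0
    · exact absurd h0 (mul_ne_zero hr3 hD)

/-- ★★ BRIDGE PH-W BY NAME (`ProfileHorn.HornWindowSilence`, g10-2's PROFILE HORN line; fixed form `Q`, time-dependent profile): in a bounded mild
window all of whose slices are separable `l = 2` shells `sepShell (H t) Q x₀` with horn-admissible profiles, at every time `Q` is zonal or the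
profile solves the horn equation. -/
theorem hornWindowSilence_holds : ProfileHorn.HornWindowSilence := by
  intro S hS u x₀ hcont hdiv hmild hbdd Q H hQ hslice t ht
  exact hornWindowSilenceVar_holds S hS u x₀ hcont hdiv hmild hbdd H (fun _ => Q)
    (fun τ hτ => ⟨(hslice τ hτ).1, hQ, (hslice τ hτ).2⟩) t ht

end Summit.NavierStokesRegularity.NavierStokesRegularity.Theorems.UnthreadedRigidity.HornPressure

end
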